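import Summits.ABC.ABC.Theorems.SomeWindowSaving.Negative.Defs

/-!
# Window slices of the crux `TwistAmplification.SomeWindowSaving` are finite

Negative-side support (cdisprove of stmt-ABC-1976): `windowSet κ σ X` is finite for all real
`κ σ X`, so the crux's `Set.ncard` is an honest finite count.  Ingredients: `1 ≤ N ≤ X` and
`|c₄|³, |Δ| ≤ M⁺ ≤ N^σ` bound `c₄`; `c₆² = c₄³ − 1728Δ` bounds `c₆`; `W ↦ (a₁,a₂,a₃,c₄,c₆)` is
injective over `ℤ`.
-/

noncomputable section

open UniqueFactorizationMonoid IsDedekindDomain Real WeierstrassCurve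

namespace Summit.ABC.ABC.Theorems.SomeWindowSaving.Negative

section Finite

/-- The covariant map `W ↦ (a₁, a₂, a₃, c₄, c₆)` is injective over `ℤ` (so reduced models in a
window are pinned by finitely many integers: the count is an honest finite count). -/
theorem covariant_injective :
    Function.Injective (fun W : WeierstrassCurve ℤ ↦ (W.a₁, W.a₂, W.a₃, W.c₄, W.c₆)) := by
  intro W W' h
  simp only [Prod.mk.injEq] at h
  obtain ⟨h1, h2, h3, h4, h6⟩ := h
  have hb₂ : W.b₂ = W'.b₂ := by simp only [WeierstrassCurve.b₂, h1, h2]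
  have hc₄ : W.b₂ ^ 2 - 24 * W.b₄ = W'.b₂ ^ 2 - 24 * W'.b₄ := h4
  have hb₄ : W.b₄ = W'.b₄ := by
    apply mul_left_cancel₀ (by norm_num : (24 : ℤ) ≠ 0)
    rw [hb₂] at hc₄; linarith
  have ha₄ : W.a₄ = W'.a₄ := by
    have e : 2 * W.a₄ + W.a₁ * W.a₃ = 2 * W'.a₄ + W'.a₁ * W'.a₃ := hb₄
    rw [h1, h3] at e
    apply mul_left_cancel₀ (by norm_num : (2 : ℤ) ≠ 0); linarith
  have hc₆ : -W.b₂ ^ 3 + 36 * W.b₂ * W.b₄ - 216 * W.b₆ =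
      -W'.b₂ ^ 3 + 36 * W'.b₂ * W'.b₄ - 216 * W'.b₆ := h6
  have hb₆ : W.b₆ = W'.b₆ := by
    rw [hb₂, hb₄] at hc₆
    apply mul_left_cancel₀ (by norm_num : (216 : ℤ) ≠ 0); linarith
  have ha₆ : W.a₆ = W'.a₆ := by
    have e : W.a₃ ^ 2 + 4 * W.a₆ = W'.a₃ ^ 2 + 4 * W'.a₆ := hb₆
    rw [h3] at e
    apply mul_left_cancel₀ (by norm_num : (4 : ℤ) ≠ 0); linarith
  ext <;> assumption

/-- For an integer `z`, `|z| ≤ |z| ^ n` (`n ≠ 0`). -/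
theorem abs_le_abs_pow (z : ℤ) {n : ℕ} (hn : n ≠ 0) : |z| ≤ |z| ^ n := by
  have h : (z.natAbs : ℤ) ≤ ((z.natAbs ^ n : ℕ) : ℤ) := by exact_mod_cast Nat.le_self_pow hn _
  push_cast at h
  exact h

/-- A priori bounds in a window slice: `|c₄| ≤ R` and `|c₆| ≤ 1729 R`, `R = max (X^σ) 1`
(from `|c₄|³, |Δ| ≤ M⁺ ≤ N^σ`, `1 ≤ N ≤ X`, and `c₆² = c₄³ − 1728 Δ`). -/
theorem abs_c₄_c₆_le_of_mem {κ σ X : ℝ} {W : WeierstrassCurve ℤ} (h : W ∈ windowSet κ σ X) :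
    ((|W.c₄| : ℤ) : ℝ) ≤ max (X ^ σ) 1 ∧ ((|W.c₆| : ℤ) : ℝ) ≤ 1729 * max (X ^ σ) 1 := by
  obtain ⟨hE, -, -, -, -, -, -, hNX, -, hM⟩ := h
  set R : ℝ := max (X ^ σ) 1 with hR
  have hR1 : 1 ≤ R := le_max_right _ _
  have hN1 : (1 : ℝ) ≤ (((W.baseChange ℚ).conductorNorm ℤ : ℕ) : ℝ) := by
    exact_mod_cast conductorNorm_pos_holds (W.baseChange ℚ)
  have hNσ : (((W.baseChange ℚ).conductorNorm ℤ : ℕ) : ℝ) ^ σ ≤ R := by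
    rcases le_or_gt 0 σ with hσ | hσ
    · exact (Real.rpow_le_rpow (by positivity) hNX hσ).trans (le_max_left _ _)
    · exact (Real.rpow_le_one_of_one_le_of_nonpos hN1 hσ.le).trans (le_max_right _ _)
  have hM' : ((max |W.Δ| (|W.c₄| ^ 3) : ℤ) : ℝ) ≤ R := hM.trans hNσ
  have hΔ : ((|W.Δ| : ℤ) : ℝ) ≤ R := le_trans (by exact_mod_cast le_max_left _ _) hM'
  have hc₄3 : ((|W.c₄| ^ 3 : ℤ) : ℝ) ≤ R := le_trans (by exact_mod_cast le_max_right _ _) hM'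
  have hc₄ : ((|W.c₄| : ℤ) : ℝ) ≤ R :=
    le_trans (by exact_mod_cast abs_le_abs_pow W.c₄ three_ne_zero) hc₄3
  refine ⟨hc₄, ?_⟩
  have hrel : (W.c₆ : ℤ) ^ 2 = W.c₄ ^ 3 - 1728 * W.Δ := by
    have := W.c_relation
    linarith
  have hsq : ((|W.c₆| : ℤ) : ℝ) ≤ ((W.c₆ ^ 2 : ℤ) : ℝ) := by
    have := abs_le_abs_pow W.c₆ two_ne_zero
    rw [sq_abs] at this
    exact_mod_cast this
  have hc₄3' : ((W.c₄ ^ 3 : ℤ) : ℝ) ≤ R := by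
    refine le_trans ?_ hc₄3
    have : W.c₄ ^ 3 ≤ |W.c₄| ^ 3 := by
      calc W.c₄ ^ 3 ≤ |W.c₄ ^ 3| := le_abs_self _
        _ = |W.c₄| ^ 3 := abs_pow _ _
    exact_mod_cast this
  have hΔ' : -((W.Δ : ℤ) : ℝ) ≤ R := by
    refine le_trans ?_ hΔ
    exact_mod_cast neg_le_abs W.Δ
  calc ((|W.c₆| : ℤ) : ℝ) ≤ ((W.c₆ ^ 2 : ℤ) : ℝ) := hsq
    _ = ((W.c₄ ^ 3 : ℤ) : ℝ) - 1728 * ((W.Δ : ℤ) : ℝ) := by rw [hrel]; push_cast; ring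
    _ ≤ R + 1728 * R := by linarith
    _ = 1729 * R := by ring

/-- **Every window slice is finite** (no arithmetic input beyond `N ≥ 1`): `Set.ncard` in the crux is
an honest count. -/
theorem windowSet_finite (κ σ X : ℝ) : (windowSet κ σ X).Finite := by
  set R : ℝ := max (X ^ σ) 1 with hR
  set T : ℤ := ⌈1729 * R⌉ with hT
  have hS : (Set.Icc (0 : ℤ) 1 ×ˢ (Set.Icc (-1 : ℤ) 1 ×ˢ (Set.Icc (0 : ℤ) 1 ×ˢ
      (Set.Icc (-T) T ×ˢ Set.Icc (-T) T)))).Finite :=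
    (Set.finite_Icc _ _).prod ((Set.finite_Icc _ _).prod ((Set.finite_Icc _ _).prod
      ((Set.finite_Icc _ _).prod (Set.finite_Icc _ _))))
  refine (hS.preimage covariant_injective.injOn).subset fun W hW ↦ ?_
  obtain ⟨hc₄, hc₆⟩ := abs_c₄_c₆_le_of_mem hW
  obtain ⟨-, -, ha₁, ha₃, ha₂, -⟩ := hW
  have hR1 : 1 ≤ R := le_max_right _ _
  have hTz : ∀ z : ℤ, ((|z| : ℤ) : ℝ) ≤ 1729 * R → -T ≤ z ∧ z ≤ T := by
    intro z hz
    have hzT : |z| ≤ T := by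
      have : ((|z| : ℤ) : ℝ) ≤ T := hz.trans (Int.le_ceil _)
      exact_mod_cast this
    exact abs_le.mp hzT
  simp only [Set.mem_preimage, Set.mem_prod, Set.mem_Icc]
  refine ⟨⟨by omega, by omega⟩, ⟨by omega, by omega⟩, ⟨by omega, by omega⟩,
    hTz _ (hc₄.trans ?_), hTz _ hc₆⟩
  linarith

end Finite

end Summit.ABC.ABC.Theorems.SomeWindowSaving.Negative
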